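import Summits.AtomisticToContinuum.HydrodynamicLimit.Theorems.CollisionIsometryCLTCollisionalTransferLocalityBlockFields
import HarnessLib

/-!
# Pathwise velocity-moment envelope of the Euler-weighted collisional pressure functional
(registered stub `abs_integral_eulerW_pcoll_le_velAvg`, [Re])

Helper file (`--supports stmt-AtomisticToContinuum-9518`, line `hemisphere-affine-slaving`, skeleton
v11) for the crux `CollisionalTransferLocality`. The lead proves the `Rhs` side of the equilibrium
rung with the time-integral-in-probability engine, which needs a uniform second-moment bound of the
slice functional `w ↦ ∫ₓ eulerW · p_c(ρ̄, θ̄)`; this file lands its PATHWISE ENVELOPE on dilute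
configurations (`ρ̄σ³ ≤ η₁ ≤ η_Z` everywhere, where `|Z(η) − 1| ≤ Kη` on `[0, η_Z]`) by the velocity
averages `A₂ = (N+1)⁻¹ Σᵢ ‖vᵢ‖²`, `A₄ = (N+1)⁻¹ Σᵢ ‖vᵢ‖⁴`:
`|∫ₓ eulerW · p_c(ρ̄, θ̄)| ≤ C₁ K η₁ (2 A₂ + A₄)`.

Proof. Pointwise at each `x` (`abs_eulerW_mul_pcoll_le`): `p_c = pkin (Z(ρ̄σ³) − 1)` with
`0 ≤ pkin ≤ (2/3) Ē` (weighted Cauchy–Schwarz `|m̄|² ≤ 2ρ̄Ē`; `pkin = 0` on empty blocks by the junk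
value `x/0 = 0`), `|Z(ρ̄σ³) − 1| ≤ K ρ̄σ³ ≤ K η₁`, `|div ψ| ≤ C₁`, `|Σⱼ ∂ⱼχ ūⱼ| ≤ 3 C₁ ‖ū‖` and
`‖ū‖ ρ̄ ≤ ‖m̄‖`, whence `|eulerW · p_c| ≤ (2/3) C₁Kη₁ Ē + 2 C₁Kσ³ ‖m̄‖ Ē`; then
`2‖m̄‖Ē ≤ ‖m̄‖² + Ē²`, `‖m̄‖² ≤ 2ρ̄Ē`, and the weighted Cauchy–Schwarz
`Ē² ≤ ρ̄ · (N+1)⁻¹ Σᵢ φᵢ ‖vᵢ‖⁴ / 4` (`EB_sq_le`) give, on a dilute block,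
`|eulerW · p_c| ≤ C₁ K η₁ (4 Ē + (N+1)⁻¹ Σᵢ φ(xᵢ − x) ‖vᵢ‖⁴)`. The right side is continuous in `x`,
hence an honest dominating integrand on the compact torus (`norm_integral_le_of_norm_le`), and
`∫ₓ Ē = A₂/2` (`integral_EB`), `∫ₓ φ(xᵢ − x) dx = ∫ φ = 1` (invariance of Haar measure,
`integral_velFour`). Folklore; no source is cited (Chapman–Cowling 1970 §16.4 and Spohn 1991 I §3 are
the background for the block fields, recorded on the imported tools).
-/

namespace Summit.AtomisticToContinuum.HydrodynamicLimit.Theorems.HemisphereAffineSlaving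

open scoped BigOperators Topology Classical ENNReal InnerProductSpace
open Filter Set Function MeasureTheory

noncomputable section

open Literature.MathematicalPhysics.KineticTheory (T3 V3)

namespace RhsEnvelope

open Literature.MathematicalPhysics.KineticTheory (hsCompressibility hsPressure)
open Literature.Analysis.FluidPDE (configEnergy)

variable {N : ℕ} {φ : ℕ → T3 → ℝ} {w : Cfg N} {x : T3}

/-- `p_c(ρ̄, θ̄) = pkin · (Z(ρ̄σ³) − 1)`. [folklore] -/
theorem pcoll_eq_pkin_mul (σ : ℝ) (φ : ℕ → T3 → ℝ) (w : Cfg N) (x : T3) :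
    pcoll σ (rhoB φ N w x) (thetaB φ N w x) =
      pkin φ N w x * (hsCompressibility (rhoB φ N w x * σ ^ 3) - 1) := by
  simp only [pcoll, hsPressure, pkin]
  ring

/-- `0 ≤ pkin ≤ (2/3) Ē` for a nonnegative kernel (`pkin = (2/3)(Ē − |m̄|²/(2ρ̄))` off empty blocks,
`|m̄|² ≤ 2ρ̄Ē`; `pkin = 0 · θ̄ = 0` on empty blocks). [folklore] -/
theorem pkin_nonneg_le (hφ0 : ∀ y, 0 ≤ φ N y) :
    0 ≤ pkin φ N w x ∧ pkin φ N w x ≤ 2 / 3 * EB φ N w x := by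
  have hE0 : 0 ≤ EB φ N w x := EB_nonneg hφ0
  rcases (rhoB_nonneg (w := w) (x := x) hφ0).lt_or_eq with hρ | hρ
  · have hm := norm_mB_sq_le (w := w) (x := x) hφ0
    have hPeq : pkin φ N w x =
        2 / 3 * EB φ N w x - ‖mB φ N w x‖ ^ 2 / (3 * rhoB φ N w x) := by
      simp only [pkin, thetaB]
      field_simp
    have hq0 : 0 ≤ ‖mB φ N w x‖ ^ 2 / (3 * rhoB φ N w x) := by positivity
    have hq1 : ‖mB φ N w x‖ ^ 2 / (3 * rhoB φ N w x) ≤ 2 / 3 * EB φ N w x := by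
      rw [div_le_iff₀ (by positivity)]
      nlinarith
    rw [hPeq]
    constructor <;> linarith
  · have hP : pkin φ N w x = 0 := by rw [pkin, ← hρ, zero_mul]
    rw [hP]
    exact ⟨le_rfl, mul_nonneg (by norm_num) hE0⟩

/-- `‖ū‖ ρ̄ ≤ ‖m̄‖` (equality off empty blocks, `0 ≤ ‖m̄‖` on them). [folklore] -/
theorem norm_uB_mul_rhoB_le (hφ0 : ∀ y, 0 ≤ φ N y) :
    ‖uB φ N w x‖ * rhoB φ N w x ≤ ‖mB φ N w x‖ := by
  have hρ := rhoB_nonneg (w := w) (x := x) hφ0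
  rw [uB, norm_smul, Real.norm_eq_abs, abs_inv, abs_of_nonneg hρ]
  rcases eq_or_ne (rhoB φ N w x) 0 with h0 | h0
  · rw [h0, mul_zero]
    exact norm_nonneg _
  · rw [mul_comm, ← mul_assoc, mul_inv_cancel₀ h0, one_mul]

/-- Weighted Cauchy–Schwarz for the block energy:
`Ē² ≤ ρ̄ · ((N+1)⁻¹ Σᵢ φ(xᵢ − x) ‖vᵢ‖⁴) / 4`. [folklore] -/
theorem EB_sq_le (hφ0 : ∀ y, 0 ≤ φ N y) :
    EB φ N w x ^ 2 ≤ rhoB φ N w x *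
      (((N + 1 : ℕ) : ℝ)⁻¹ * ∑ i, φ N ((w i).1 - x) * ‖(w i).2‖ ^ 4) / 4 := by
  rw [EB_eq, rhoB_eq]
  have ha : ∀ i, 0 ≤ φ N ((w i).1 - x) := fun i => hφ0 _
  have hCS : (∑ i, φ N ((w i).1 - x) * (‖(w i).2‖ ^ 2 / 2)) ^ 2 ≤
      (∑ i, φ N ((w i).1 - x)) * ∑ i, φ N ((w i).1 - x) * (‖(w i).2‖ ^ 2 / 2) ^ 2 :=
    Finset.sum_sq_le_sum_mul_sum_of_sq_le_mul _ (fun i _ => ha i)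
      (fun i _ => mul_nonneg (ha i) (sq_nonneg _)) (fun i _ => le_of_eq (by ring))
  have h4 : ∑ i, φ N ((w i).1 - x) * (‖(w i).2‖ ^ 2 / 2) ^ 2 =
      (∑ i, φ N ((w i).1 - x) * ‖(w i).2‖ ^ 4) / 4 := by
    rw [Finset.sum_div]
    exact Finset.sum_congr rfl fun i _ => by ring
  rw [h4] at hCS
  have hc : 0 ≤ ((N + 1 : ℕ) : ℝ)⁻¹ := by positivity
  calc (((N + 1 : ℕ) : ℝ)⁻¹ * ∑ i, φ N ((w i).1 - x) * (‖(w i).2‖ ^ 2 / 2)) ^ 2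
      = ((N + 1 : ℕ) : ℝ)⁻¹ ^ 2 * (∑ i, φ N ((w i).1 - x) * (‖(w i).2‖ ^ 2 / 2)) ^ 2 := by ring
    _ ≤ ((N + 1 : ℕ) : ℝ)⁻¹ ^ 2 *
        ((∑ i, φ N ((w i).1 - x)) * ((∑ i, φ N ((w i).1 - x) * ‖(w i).2‖ ^ 4) / 4)) :=
        mul_le_mul_of_nonneg_left hCS (sq_nonneg _)
    _ = _ := by ring

/-- **Pointwise envelope.** On a block with `ρ̄σ³ ≤ η₁ ≤ η_Z`, for `|Z(η) − 1| ≤ Kη` on `[0, η_Z]`,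
`|div ψ| ≤ C₁` and `|∂ⱼχ| ≤ C₁`:
`|eulerW · p_c(ρ̄, θ̄)| ≤ C₁ K η₁ (4 Ē + (N+1)⁻¹ Σᵢ φ(xᵢ − x) ‖vᵢ‖⁴)`. [folklore] -/
theorem abs_eulerW_mul_pcoll_le {σ K ηZ η₁ C₁ : ℝ} (hσ : 0 < σ) (hK : 0 ≤ K) (hη₁ : 0 ≤ η₁)
    (hη₁Z : η₁ ≤ ηZ) (hC₁ : 0 ≤ C₁)
    (hZ : ∀ η : ℝ, 0 ≤ η → η ≤ ηZ → |hsCompressibility η - 1| ≤ K * η)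
    (hφ0 : ∀ y, 0 ≤ φ N y) {ψ : ℝ → T3 → V3} {χ : ℝ → T3 → ℝ} {s : ℝ}
    (hdiv : |divPsi ψ s x| ≤ C₁) (hgrad : ∀ a, |gradChi χ s x a| ≤ C₁)
    (hhi : rhoB φ N w x * σ ^ 3 ≤ η₁) :
    |eulerW ψ χ φ N s w x * pcoll σ (rhoB φ N w x) (thetaB φ N w x)| ≤
      C₁ * K * η₁ * (4 * EB φ N w x +
        ((N + 1 : ℕ) : ℝ)⁻¹ * ∑ i, φ N ((w i).1 - x) * ‖(w i).2‖ ^ 4) := by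
  have hρ0 : 0 ≤ rhoB φ N w x := rhoB_nonneg hφ0
  have hE0 : 0 ≤ EB φ N w x := EB_nonneg hφ0
  have hσ3 : 0 ≤ σ ^ 3 := pow_nonneg hσ.le 3
  have hη0 : 0 ≤ rhoB φ N w x * σ ^ 3 := mul_nonneg hρ0 hσ3
  obtain ⟨hP0, hPE⟩ := pkin_nonneg_le (w := w) (x := x) hφ0
  have hZm : |hsCompressibility (rhoB φ N w x * σ ^ 3) - 1| ≤ K * (rhoB φ N w x * σ ^ 3) :=
    hZ _ hη0 (hhi.trans hη₁Z)
  have hu := norm_uB_mul_rhoB_le (w := w) (x := x) hφ0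
  have hm2 := norm_mB_sq_le (w := w) (x := x) hφ0
  have hE2 := EB_sq_le (w := w) (x := x) hφ0
  have hF0 : 0 ≤ ((N + 1 : ℕ) : ℝ)⁻¹ * ∑ i, φ N ((w i).1 - x) * ‖(w i).2‖ ^ 4 :=
    mul_nonneg (by positivity) (Finset.sum_nonneg fun i _ => mul_nonneg (hφ0 _) (by positivity))
  have hcσ : 0 ≤ C₁ * K * σ ^ 3 := mul_nonneg (mul_nonneg hC₁ hK) hσ3
  have hEF : 0 ≤ 2 * EB φ N w x +
      (((N + 1 : ℕ) : ℝ)⁻¹ * ∑ i, φ N ((w i).1 - x) * ‖(w i).2‖ ^ 4) / 4 :=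
    add_nonneg (mul_nonneg zero_le_two hE0) (div_nonneg hF0 (by norm_num))
  -- the Euler weight: `|div ψ + Σⱼ ∂ⱼχ ūⱼ| ≤ C₁ + 3 C₁ ‖ū‖`
  have hS : |∑ j, gradChi χ s x j * uB φ N w x j| ≤ 3 * C₁ * ‖uB φ N w x‖ := by
    calc |∑ j, gradChi χ s x j * uB φ N w x j| ≤ ∑ j, |gradChi χ s x j * uB φ N w x j| :=
          Finset.abs_sum_le_sum_abs _ _
      _ ≤ ∑ _j : Fin 3, C₁ * ‖uB φ N w x‖ := Finset.sum_le_sum fun j _ => by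
          rw [abs_mul]
          refine mul_le_mul (hgrad j) ?_ (abs_nonneg _) hC₁
          rw [← Real.norm_eq_abs]
          exact PiLp.norm_apply_le _ j
      _ = 3 * C₁ * ‖uB φ N w x‖ := by
          simp only [Finset.sum_const, Finset.card_univ, Fintype.card_fin, nsmul_eq_mul]
          push_cast
          ring
  have hW : |eulerW ψ χ φ N s w x| ≤ C₁ + 3 * C₁ * ‖uB φ N w x‖ := by
    unfold eulerW
    exact (abs_add_le _ _).trans (add_le_add hdiv hS)
  -- main chain
  rw [pcoll_eq_pkin_mul, abs_mul, abs_mul, abs_of_nonneg hP0]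
  calc |eulerW ψ χ φ N s w x| * (pkin φ N w x * |hsCompressibility (rhoB φ N w x * σ ^ 3) - 1|)
      ≤ (C₁ + 3 * C₁ * ‖uB φ N w x‖) * (pkin φ N w x * (K * (rhoB φ N w x * σ ^ 3))) :=
        mul_le_mul hW (mul_le_mul_of_nonneg_left hZm hP0) (by positivity) (by positivity)
    _ = C₁ * K * (rhoB φ N w x * σ ^ 3) * pkin φ N w x +
        3 * C₁ * K * σ ^ 3 * (‖uB φ N w x‖ * rhoB φ N w x) * pkin φ N w x := by ring
    _ ≤ C₁ * K * η₁ * pkin φ N w x + 3 * C₁ * K * σ ^ 3 * ‖mB φ N w x‖ * pkin φ N w x :=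
        add_le_add (mul_le_mul_of_nonneg_right (mul_le_mul_of_nonneg_left hhi (by positivity)) hP0)
          (mul_le_mul_of_nonneg_right (mul_le_mul_of_nonneg_left hu (by positivity)) hP0)
    _ ≤ C₁ * K * η₁ * (2 / 3 * EB φ N w x) +
        3 * C₁ * K * σ ^ 3 * ‖mB φ N w x‖ * (2 / 3 * EB φ N w x) :=
        add_le_add (mul_le_mul_of_nonneg_left hPE (by positivity))
          (mul_le_mul_of_nonneg_left hPE (by positivity))
    _ = 2 / 3 * C₁ * K * η₁ * EB φ N w x +
        C₁ * K * σ ^ 3 * (2 * ‖mB φ N w x‖ * EB φ N w x) := by ring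
    _ ≤ 2 / 3 * C₁ * K * η₁ * EB φ N w x +
        C₁ * K * σ ^ 3 * (‖mB φ N w x‖ ^ 2 + EB φ N w x ^ 2) :=
        add_le_add le_rfl (mul_le_mul_of_nonneg_left
          (two_mul_le_add_sq ‖mB φ N w x‖ (EB φ N w x)) hcσ)
    _ ≤ 2 / 3 * C₁ * K * η₁ * EB φ N w x +
        C₁ * K * σ ^ 3 * (2 * rhoB φ N w x * EB φ N w x + rhoB φ N w x *
          (((N + 1 : ℕ) : ℝ)⁻¹ * ∑ i, φ N ((w i).1 - x) * ‖(w i).2‖ ^ 4) / 4) :=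
        add_le_add le_rfl (mul_le_mul_of_nonneg_left (add_le_add hm2 hE2) hcσ)
    _ = 2 / 3 * C₁ * K * η₁ * EB φ N w x +
        C₁ * K * (rhoB φ N w x * σ ^ 3) * (2 * EB φ N w x +
          (((N + 1 : ℕ) : ℝ)⁻¹ * ∑ i, φ N ((w i).1 - x) * ‖(w i).2‖ ^ 4) / 4) := by ring
    _ ≤ 2 / 3 * C₁ * K * η₁ * EB φ N w x +
        C₁ * K * η₁ * (2 * EB φ N w x +
          (((N + 1 : ℕ) : ℝ)⁻¹ * ∑ i, φ N ((w i).1 - x) * ‖(w i).2‖ ^ 4) / 4) :=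
        add_le_add le_rfl (mul_le_mul_of_nonneg_right
          (mul_le_mul_of_nonneg_left hhi (mul_nonneg hC₁ hK)) hEF)
    _ = C₁ * K * η₁ * (8 / 3 * EB φ N w x +
          (((N + 1 : ℕ) : ℝ)⁻¹ * ∑ i, φ N ((w i).1 - x) * ‖(w i).2‖ ^ 4) / 4) := by ring
    _ ≤ C₁ * K * η₁ * (4 * EB φ N w x +
          ((N + 1 : ℕ) : ℝ)⁻¹ * ∑ i, φ N ((w i).1 - x) * ‖(w i).2‖ ^ 4) :=
        mul_le_mul_of_nonneg_left (by nlinarith) (by positivity)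

/-- `∫ₓ (N+1)⁻¹ Σᵢ φ(xᵢ − x) ‖vᵢ‖⁴ dx = (N+1)⁻¹ Σᵢ ‖vᵢ‖⁴` for a continuous kernel of mass one (finite
sum out of the integral, `∫ₓ φ(xᵢ − x) dx = ∫ φ = 1` by invariance of Haar measure). [folklore] -/
theorem integral_velFour (hφc : Continuous (φ N)) (hφ1 : ∫ y, φ N y = 1) (w : Cfg N) :
    ∫ x, ((N + 1 : ℕ) : ℝ)⁻¹ * ∑ i, φ N ((w i).1 - x) * ‖(w i).2‖ ^ 4 =
      ((N + 1 : ℕ) : ℝ)⁻¹ * ∑ i, ‖(w i).2‖ ^ 4 := by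
  haveI : (volume : Measure T3).IsNegInvariant := Measure.IsAddHaarMeasure.isNegInvariant_of_regular _
  have hint : ∀ i, Integrable (fun x : T3 => φ N ((w i).1 - x)) := fun i =>
    hφc.integrable_unitAddTorus.comp_sub_left (w i).1
  rw [integral_const_mul, integral_finsetSum _ fun i _ => (hint i).mul_const _]
  simp_rw [integral_mul_const, integral_sub_left_eq_self (φ N) volume, hφ1, one_mul]

end RhsEnvelope

open RhsEnvelope in
/-- **[Re] Pathwise velocity-moment envelope of the Euler-weighted collisional pressure functional on a
dilute configuration** (registered helper stub of skeleton v11 of the line `hemisphere-affine-slaving`,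
crux stmt-AtomisticToContinuum-9518): for `σ > 0`, `K ≥ 0`, `0 < η₁ ≤ η_Z`, `C₁ ≥ 0` with
`|Z(η) − 1| ≤ Kη` on `[0, η_Z]`, a continuous nonnegative kernel of mass one, tests with `|div ψ| ≤ C₁`,
`|∂ⱼχ| ≤ C₁`, and a configuration `w` with `ρ̄σ³ ≤ η₁` everywhere,
`|∫ₓ eulerW · p_c(ρ̄, θ̄)| ≤ C₁ K η₁ (2 A₂ + A₄)`, `A_k = (N+1)⁻¹ Σᵢ ‖vᵢ‖ᵏ`. [folklore] -/
theorem abs_integral_eulerW_pcoll_le_velAvg : ∀ (σ K ηZ η₁ C₁ : ℝ), 0 < σ → 0 ≤ K → 0 < η₁ → η₁ ≤ ηZ → 0 ≤ C₁ → (∀ η : ℝ, 0 ≤ η → η ≤ ηZ → |Literature.MathematicalPhysics.KineticTheory.hsCompressibility η - 1| ≤ K * η) → ∀ (φ : ℕ → T3 → ℝ) (N : ℕ), Continuous (φ N) → (∀ y, 0 ≤ φ N y) → ∫ y, φ N y = 1 → ∀ (ψ : ℝ → T3 → V3) (χ : ℝ → T3 → ℝ) (s : ℝ), (∀ y, |divPsi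 ψ s y| ≤ C₁) → (∀ y a, |gradChi χ s y a| ≤ C₁) → ∀ w : Cfg N, (∀ x, rhoB φ N w x * σ ^ 3 ≤ η₁) → |∫ x, eulerW ψ χ φ N s w x * pcoll σ (rhoB φ N w x) (thetaB φ N w x)| ≤ C₁ * K * η₁ * (2 * (((N : ℝ) + 1)⁻¹ * ∑ i : Fin (N + 1), ‖(w i).2‖ ^ 2) + ((N : ℝ) + 1)⁻¹ * ∑ i : Fin (N + 1), ‖(w i).2‖ ^ 4) := by
  intro σ K ηZ η₁ C₁ hσ hK hη₁ hη₁Z hC₁ hZ φ N hφc hφ0 hφ1 ψ χ s hdiv hgrad w hdil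
  have hEint : Integrable (fun x => EB φ N w x) :=
    ((continuous_EB hφc).comp (continuous_const.prodMk continuous_id)).integrable_unitAddTorus
  have hFc : Continuous fun x : T3 =>
      ((N + 1 : ℕ) : ℝ)⁻¹ * ∑ i, φ N ((w i).1 - x) * ‖(w i).2‖ ^ 4 := by
    fun_prop
  have hFint := hFc.integrable_unitAddTorus
  have hgi : Integrable (fun x => C₁ * K * η₁ * (4 * EB φ N w x +
      ((N + 1 : ℕ) : ℝ)⁻¹ * ∑ i, φ N ((w i).1 - x) * ‖(w i).2‖ ^ 4)) :=
    ((hEint.const_mul 4).add hFint).const_mul _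
  rw [← Real.norm_eq_abs]
  refine (norm_integral_le_of_norm_le hgi (ae_of_all _ fun x => ?_)).trans (le_of_eq ?_)
  · rw [Real.norm_eq_abs]
    exact abs_eulerW_mul_pcoll_le hσ hK hη₁.le hη₁Z hC₁ hZ hφ0 (hdiv x) (hgrad x) (hdil x)
  · rw [integral_const_mul, integral_add (hEint.const_mul 4) hFint, integral_const_mul,
      integral_EB hφc hφ1, integral_velFour hφc hφ1]
    simp only [Literature.Analysis.FluidPDE.configEnergy, Nat.cast_add, Nat.cast_one]
    ring

end

end Summit.AtomisticToContinuum.HydrodynamicLimit.Theorems.HemisphereAffineSlaving
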